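import Literature.NumberTheory.Automorphic.ReciprocityGLn
import HarnessLib

/-!
# HLTT-compatibility: the characterising property of `r_{ℓ,ι}(π)` (facts-free vocabulary)

Topic `Literature/NumberTheory/Automorphic`.  This module is the **named-fact-free home** of the
vocabulary of Harris–Lan–Taylor–Thorne's Theorem A — the property characterising the Galois
representation `r_{ℓ,ι}(π)` attached to a regular algebraic cuspidal automorphic representation
`π` of `GL_n(𝔸_K)` — together with its proved API.  It imports only
`Literature.NumberTheory.Automorphic.ReciprocityGLn` (for `AutomorphicRepData`,
`HasSatakeParamAt`, `IsUnramifiedAt`, `hasSatakeParamAt_cofinite`, `arithFrobPolyOfSatake`,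
`FramedGaloisRep.IsUnramifiedAt`, `FramedGaloisRep.HasFrobCharpolyAt`,
`HeightOneSpectrum.residueCard`), so that a route, or a Literature fact such as
`ACCGHLNSTT2023.automorphyLifting_crystalline_weightZero`, can *name* the HLTT property without
taking the three undischarged XL named facts of
`Literature.NumberTheory.Automorphic.ReciprocityGLnProofs`
(`HarrisLanTaylorThorne2016.theoremA_existence`, `HarrisLanTaylorThorne2016.theoremA_uniqueness`,
`Varma2024.corollary93_unramified`) into its import cone (definition request
`defn-HLTTCompatible` of route `Langlands/StickelbergerDial`, 2026-08-17, whose items had to write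
the predicate out three times for that reason).

Source.  Harris–Lan–Taylor–Thorne, *On the rigid cohomology of certain Shimura varieties*,
Res. Math. Sci. 3:37 (2016), **Theorem A** (p. 3; read 2026-08-17 from the held text
`paper:doi-10-1186-s40687-016-0078-5`, p0003): "Let `p` be a rational prime and `ı : ℚ̄_p ≅ ℂ`.
Suppose that `E` is a CM (or totally real) field and that `π` is a cuspidal automorphic
representation of `GL_n(𝔸_E)` such that `π_∞` has the same infinitesimal character as an
irreducible algebraic representation `ρ_π` of `RS^E_ℚ GL_n`.  Then there is a unique continuous
semi-simple representation `r_{p,ı}(π) : G_E → GL_n(ℚ̄_p)` such that, if `q ≠ p` is a rational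
prime above which `π` is unramified and if `v ∣ q` is a prime of `E`, then `r_{p,ı}(π)` is
unramified at `v` and `r_{p,ı}(π)|^{ss}_{W_{E_v}} = ı⁻¹ rec_{E_v}(π_v |det|_v^{(1-n)/2})`"; the
existence part is **Corollary 7.14** (p. 232, p0232, same wording with `F-ss`).  For the
unramified `π_v` the displayed identity says: every arithmetic Frobenius at `v` has
characteristic polynomial `arithFrobPolyOfSatake ı q_v n α = ∏_j (X - ı⁻¹((q_v^{(n-1)/2} α_j)⁻¹))`
for the Satake parameter `α` of `π_v` (the tree's arithmetic-Frobenius convention, review 13 of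
`ReciprocityGLn`).  The theorem itself (existence, uniqueness) and Varma's extension to every
`v ∤ ℓ` stay in `ReciprocityGLnProofs` as named facts; nothing here is a fact.

## Contents (namespace `Literature.NumberTheory.Automorphic.HLTT`)

* `HLTT.IsUnramifiedAbove π q` — `π` is unramified (has a Satake parameter) at every finite place
  `w` of `K` over the rational prime `q` (`(q : 𝓞 K) ∈ w`): Thm. A's "a rational prime above
  which `π` is unramified".  API `isUnramifiedAbove_iff` (`Iff.rfl`) and
  `isUnramifiedAbove_cofinite`: granted `π.hasSatakeParamAt_cofinite` (Flath; a hypothesis, not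
  a fact of this file), `π` is unramified above all but finitely many rational primes.
* `HLTT.IsGaloisCompatibleAt π ι r v` — unramified local–global compatibility of the framed
  `r : Γ_K → GL_n(ℚ̄_ℓ)` with `π` at one place `v`: for every Satake parameter `α` of `π` at `v`,
  `r` is unramified at `v` with arithmetic-Frobenius characteristic polynomial
  `arithFrobPolyOfSatake ι q_v n α` (the compatibility clause of **lang.S27**,
  `exists_galoisRep_of_regularAlgebraic`; vacuous where `π` is ramified).  API
  `isGaloisCompatibleAt_iff` (`Iff.rfl`), `isGaloisCompatibleAt_conj_iff` (change of frame).
* `HLTT.IsCompatible π ι r` — **HLTT's characterising property of `r_{ℓ,ι}(π)`** exactly as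
  printed in Thm. A = Cor. 7.14: for every rational prime `q ≠ ℓ` above which `π` is unramified
  and every place `v ∣ q`, `r` is compatible with `π` at `v`.  (No unramifiedness of `K` above
  `q`: that extra hypothesis is in the 2014 preprint arXiv:1411.6717 and in Thm. 7.13, and is
  removed in the published Thm. A / Cor. 7.14 by Sorensen's patching lemma — see "Editions
  differ" in the module docstring of `ReciprocityGLnProofs`.)  API `isCompatible_iff` (the fully
  written-out form over `HasSatakeParamAt` / `IsUnramifiedAt` / `HasFrobCharpolyAt` /
  `arithFrobPolyOfSatake`, `Iff.rfl` — this is verbatim the clause inlined in the items of route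
  `StickelbergerDial`), `isCompatible_conj_iff`, `isCompatible_of_forall_not_mem` (compatibility
  at every `v ∤ ℓ`, the conclusion of lang.S27, implies HLTT-compatibility).
* Place bookkeeping, proved, general: the rational prime below a finite place `v` is Mathlib's
  `Ideal.absNorm (v.asIdeal.under ℤ)` (`Int.absNorm_under_mem`, `Nat.absNorm_under_prime`);
  `HLTT.eq_absNorm_under_of_natCast_mem` (every rational prime in `v` is that one) and
  `HLTT.natCast_mem_asIdeal_iff_eq` (two rational primes below the same place coincide).  The
  three elementary place lemmas of `ReciprocityGLnProofs` (`natCast_not_mem_of_natCast_mem`,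
  `natPrime_eq_of_natCast_mem`, `exists_natPrime_natCast_mem`) are deliberately NOT restated
  (gate `dedup.landed`); these two lemmas and Mathlib cover their uses.  Also the G09-type lemma
  `HLTT.hasFrobCharpolyAt_conj_iff` (the Frobenius characteristic-polynomial predicate of a
  framed representation is invariant under change of frame, Mathlib `Matrix.charpoly_units_conj`).

Every declaration of this file lives in the sub-namespace `HLTT`, which no other module opens or
declares into: adding this module to an import cone therefore never offers a second candidate for
a bare name an importer already uses (the short names coincide with those of the twins in
`ReciprocityGLnProofs` and `GaloisRepresentations`).

## Relation to `ReciprocityGLnProofs` (why new names, and why the old ones stay)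

Until 2026-08-17 these notions lived only in `ReciprocityGLnProofs.lean`, next to the three
named facts, as `AutomorphicRepData.IsUnramifiedAbove`, `IsGaloisCompatibleAt`,
`HarrisLanTaylorThorne2016.IsCompatible` (with the API lemmas of the same names as here and
`FramedGaloisRep.hasFrobCharpolyAt_conj_iff`).  A same-name move is not expressible as gate
proposals (one fully-qualified name per module: `dedup.fqn-exists`; the old module cannot drop
names its 39 importers mention: `lint.removes-referenced-decl`; librarian sweeps g23 §1, g34),
so the facts-free copies carry the namespace `HLTT` and the old constants stay where they are,
**definitionally equal** to these (same bodies up to the names of the constants they unfold to;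
`Iff.rfl` bridges `HarrisLanTaylorThorne2016.isCompatible_iff_hltt` etc. are appended to
`ReciprocityGLnProofs`, which imports this module).  New facts-free clients use the `HLTT.`
names; a statement written with either family of names is interchangeable with the other by
`Iff.rfl` / `exact`.

No non-vacuity `example` can be given (no automorphic representation is constructible in the
tree, as for `ReciprocityGLn`); the sanity checks are the proved API and the `Iff.rfl` bridges
to the accepted predicates and to the written-out route items (scratch file of the proposal).

## References

* M. Harris, K.-W. Lan, R. Taylor, J. Thorne, *On the rigid cohomology of certain Shimura
  varieties*, Res. Math. Sci. 3:37 (2016), doi:10.1186/s40687-016-0078-5 — Thm. A (p. 3),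
  Thm. 7.13 and Cor. 7.14 (p. 232). [HarrisLanTaylorThorneRMS2016]
* I. Varma, *Local-global compatibility for regular algebraic cuspidal automorphic
  representations when `ℓ ≠ p`*, Forum Math. Sigma 12 (2024), e21 — Thm. 1, Cor. 9.3 (the
  extension to every `v ∤ ℓ`; vendored in `ReciprocityGLnProofs`). [VarmaFMS2024]
-/

open scoped MatrixGroups Matrix Classical Polynomial NumberField
open NumberField IsDedekindDomain Field Polynomial

noncomputable section

namespace Literature.NumberTheory.Automorphic

namespace HLTT

/-! ## Change of frame and the characteristic polynomial of Frobenius (general) -/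

section Frame

/-- The Frobenius characteristic-polynomial predicate `FramedGaloisRep.HasFrobCharpolyAt` of a
framed representation is invariant under change of frame `ρ ↦ P ρ P⁻¹` (`FramedRep.conj`;
conjugate matrices have the same characteristic polynomial, Mathlib `Matrix.charpoly_units_conj`).
General lemma of `GaloisRepresentations` type (any field `L`, any topological commutative ring
`A`), the companion of the accepted `FramedGaloisRep.isUnramifiedAt_conj_iff`; it is the
facts-free twin of `FramedGaloisRep.hasFrobCharpolyAt_conj_iff` of `ReciprocityGLnProofs` (kept
in the `HLTT` namespace, like everything in this file, so that no importer sees a second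
candidate for a bare name it already uses).
Serre 1968, Ch. I §2.3 (`P_{v,ρ}` depends only on the isomorphism class). [folklore] -/
theorem hasFrobCharpolyAt_conj_iff {L : Type*} [Field L] {A : Type*} [CommRing A]
    [TopologicalSpace A] [IsTopologicalRing A] {m : ℕ} (v : HeightOneSpectrum (𝓞 L))
    (P : GL (Fin m) A) (Q : Polynomial A) (ρ : GaloisRepresentations.FramedGaloisRep L A m) :
    GaloisRepresentations.FramedGaloisRep.HasFrobCharpolyAt v Q
        (GaloisRepresentations.FramedRep.conj P ρ) ↔ ρ.HasFrobCharpolyAt v Q := by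
  refine forall₂_congr fun 𝔓 _ => forall₂_congr fun σ _ => ?_
  have h : GaloisRepresentations.FramedRep.charpoly (GaloisRepresentations.FramedRep.conj P ρ) σ =
      GaloisRepresentations.FramedRep.charpoly ρ σ := by
    simp only [GaloisRepresentations.FramedRep.charpoly,
      GaloisRepresentations.FramedRep.conj_apply, Units.val_mul, Matrix.coe_units_inv]
    exact Matrix.charpoly_units_conj P _
  rw [h]

end Frame

/-! ## The rational prime below a finite place (Mathlib's `Ideal.under` / `Ideal.absNorm`)

The place bookkeeping of Thm. A ("a rational prime above which `π` is unramified", "`v ∣ q`")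
is done with Mathlib's canonical name for the rational prime below a finite place `v` of `K`:
`Ideal.absNorm (v.asIdeal.under ℤ)`, which lies in `v` (`Int.absNorm_under_mem`), is prime
(`Nat.absNorm_under_prime`) and divides every integer in `v` (`Int.cast_mem_ideal_iff`).  (The
elementary lemmas `natCast_not_mem_of_natCast_mem`, `natPrime_eq_of_natCast_mem`,
`exists_natPrime_natCast_mem` of `ReciprocityGLnProofs` say the same without naming the prime;
they stay there and are not restated.) -/

section Places

variable {K : Type} [Field K]

/-- **A finite place lies over exactly one rational prime**, namely
`Ideal.absNorm (v.asIdeal.under ℤ)`: every rational prime `p` with `(p : 𝓞 K) ∈ v` equals it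
(Mathlib `Int.cast_mem_ideal_iff`: the integers in `v` are the multiples of
`absNorm (v.asIdeal.under ℤ)`, which is prime, `Nat.absNorm_under_prime`). [folklore] -/
theorem eq_absNorm_under_of_natCast_mem (v : HeightOneSpectrum (𝓞 K)) {p : ℕ} (hp : p.Prime)
    (hpv : (p : 𝓞 K) ∈ v.asIdeal) : p = Ideal.absNorm (v.asIdeal.under ℤ) := by
  haveI : NeZero v.asIdeal := ⟨v.ne_bot⟩
  have hdvd : Ideal.absNorm (v.asIdeal.under ℤ) ∣ p :=
    Int.natCast_dvd_natCast.1 (Int.cast_mem_ideal_iff.1 (by simpa using hpv))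
  exact ((Nat.prime_dvd_prime_iff_eq (Nat.absNorm_under_prime v.asIdeal) hp).1 hdvd).symm

/-- Two rational primes below the same finite place coincide (both equal
`Ideal.absNorm (v.asIdeal.under ℤ)`, `eq_absNorm_under_of_natCast_mem`); equivalently, a place
over `q` is not over any other rational prime — the form used by Thm. A's "`v ∣ q`, `q ≠ p`".
[folklore] -/
theorem natCast_mem_asIdeal_iff_eq (v : HeightOneSpectrum (𝓞 K)) {q p : ℕ} (hq : q.Prime)
    (hp : p.Prime) (hqv : (q : 𝓞 K) ∈ v.asIdeal) : (p : 𝓞 K) ∈ v.asIdeal ↔ p = q := by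
  refine ⟨fun hpv ↦ ?_, fun h ↦ h ▸ hqv⟩
  rw [eq_absNorm_under_of_natCast_mem v hq hqv, eq_absNorm_under_of_natCast_mem v hp hpv]

end Places

/-! ## `π` unramified above a rational prime -/

section Unramified

variable {n : ℕ} {K : Type} [Field K] [NumberField K] {hcpt : isCompact_glFiniteIntegralLevel n K}

/-- `π` is **unramified above the rational prime `q`**: `π` is unramified (has a Satake
parameter, `AutomorphicRepData.IsUnramifiedAt`) at every finite place `w` of `K` dividing `q`
(`(q : 𝓞 K) ∈ w`).  Harris–Lan–Taylor–Thorne 2016, Thm. A ("a rational prime above which `π` is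
unramified").  Facts-free twin of `AutomorphicRepData.IsUnramifiedAbove` of
`ReciprocityGLnProofs` (same body). [cite: HarrisLanTaylorThorneRMS2016, Thm. A] -/
def IsUnramifiedAbove (π : AutomorphicRepData (AutomorphyDatum.gl n K hcpt)) (q : ℕ) : Prop :=
  ∀ w : HeightOneSpectrum (𝓞 K), ((q : ℕ) : 𝓞 K) ∈ w.asIdeal → π.IsUnramifiedAt w

/-- Unfolding lemma for `HLTT.IsUnramifiedAbove` (written out over `HasSatakeParamAt`).
[folklore] -/
lemma isUnramifiedAbove_iff (π : AutomorphicRepData (AutomorphyDatum.gl n K hcpt)) (q : ℕ) :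
    IsUnramifiedAbove π q ↔
      ∀ w : HeightOneSpectrum (𝓞 K), ((q : ℕ) : 𝓞 K) ∈ w.asIdeal →
        ∃ α : Multiset ℂ, π.HasSatakeParamAt w α :=
  Iff.rfl

/-- **An automorphic representation is unramified above all but finitely many rational primes**,
granted that it is unramified at all but finitely many places (the hypothesis
`π.hasSatakeParamAt_cofinite` of `AutomorphicRepsGL`, Flath 1979, Thm. 3): the finitely many
ramified places lie over finitely many rational primes (the prime below `w` being
`Ideal.absNorm (w.asIdeal.under ℤ)`, `eq_absNorm_under_of_natCast_mem`).  So the compatibility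
of Thm. A holds at all places outside a finite set. [folklore] -/
theorem isUnramifiedAbove_cofinite (π : AutomorphicRepData (AutomorphyDatum.gl n K hcpt))
    (hcof : π.hasSatakeParamAt_cofinite) :
    ∀ᶠ q : ℕ in Filter.cofinite, q.Prime → IsUnramifiedAbove π q := by
  -- the ramified places, a finite set
  have hB : {w : HeightOneSpectrum (𝓞 K) | ¬ π.IsUnramifiedAt w}.Finite := hcof
  -- the bad rational primes are among the primes below them
  rw [Filter.eventually_cofinite]
  refine (hB.image fun w ↦ Ideal.absNorm (w.asIdeal.under ℤ)).subset fun q hq ↦ ?_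
  simp only [Set.mem_setOf_eq, Classical.not_imp, IsUnramifiedAbove, not_forall] at hq
  obtain ⟨hqprime, w, hqw, hw⟩ := hq
  exact ⟨w, hw, (eq_absNorm_under_of_natCast_mem w hqprime hqw).symm⟩

end Unramified

/-! ## Unramified local–global compatibility at one place -/

section Compatible

variable {n : ℕ} {K : Type} [Field K] [NumberField K] {hcpt : isCompact_glFiniteIntegralLevel n K}
  {ℓ : ℕ} [Fact ℓ.Prime]

/-- **Unramified local–global compatibility of `r` with `π` at `v`**: for every Satake parameter
`α` of `π = W / W'` at the finite place `v`, the framed Galois representation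
`r : Γ_K → GL_n(ℚ̄_ℓ)` is unramified at `v` and every arithmetic Frobenius at `v` has
characteristic polynomial `arithFrobPolyOfSatake ι q_v n α = ∏_j (X - ι⁻¹((q_v^{(n-1)/2} α_j)⁻¹))`
(equivalently `r|_{W_{K_v}}^{ss} = ι⁻¹ rec_{K_v}(π_v |det|^{(1-n)/2})` for the unramified `π_v`;
review 13's Frobenius convention, see `ReciprocityGLn`).  This is the compatibility clause of
**lang.S27** (`exists_galoisRep_of_regularAlgebraic`); it is vacuous at places where `π` is
ramified (no Satake parameter).  Facts-free twin of `IsGaloisCompatibleAt` of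
`ReciprocityGLnProofs` (same body).  Harris–Lan–Taylor–Thorne 2016, Thm. A.
[cite: HarrisLanTaylorThorneRMS2016, Thm. A] -/
def IsGaloisCompatibleAt (π : AutomorphicRepData (AutomorphyDatum.gl n K hcpt))
    (ι : PadicAlgCl ℓ ≃+* ℂ) (r : GaloisRepresentations.FramedGaloisRep K (PadicAlgCl ℓ) n)
    (v : HeightOneSpectrum (𝓞 K)) : Prop :=
  ∀ α : Multiset ℂ, π.HasSatakeParamAt v α →
    r.IsUnramifiedAt v ∧ r.HasFrobCharpolyAt v (arithFrobPolyOfSatake ι v.residueCard n α)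

/-- Unfolding lemma for `HLTT.IsGaloisCompatibleAt`. [folklore] -/
theorem isGaloisCompatibleAt_iff (π : AutomorphicRepData (AutomorphyDatum.gl n K hcpt))
    (ι : PadicAlgCl ℓ ≃+* ℂ) (r : GaloisRepresentations.FramedGaloisRep K (PadicAlgCl ℓ) n)
    (v : HeightOneSpectrum (𝓞 K)) :
    IsGaloisCompatibleAt π ι r v ↔
      ∀ α : Multiset ℂ, π.HasSatakeParamAt v α →
        r.IsUnramifiedAt v ∧ r.HasFrobCharpolyAt v (arithFrobPolyOfSatake ι v.residueCard n α) :=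
  Iff.rfl

/-- Compatibility at `v` is invariant under change of frame `r ↦ P r P⁻¹`
(`FramedGaloisRep.isUnramifiedAt_conj_iff`, `hasFrobCharpolyAt_conj_iff`). [folklore] -/
theorem isGaloisCompatibleAt_conj_iff (π : AutomorphicRepData (AutomorphyDatum.gl n K hcpt))
    (ι : PadicAlgCl ℓ ≃+* ℂ) (P : GL (Fin n) (PadicAlgCl ℓ))
    (r : GaloisRepresentations.FramedGaloisRep K (PadicAlgCl ℓ) n) (v : HeightOneSpectrum (𝓞 K)) :
    IsGaloisCompatibleAt π ι (GaloisRepresentations.FramedRep.conj P r) v ↔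
      IsGaloisCompatibleAt π ι r v := by
  refine forall₂_congr fun α _ => ?_
  rw [GaloisRepresentations.FramedGaloisRep.isUnramifiedAt_conj_iff, hasFrobCharpolyAt_conj_iff]

/-! ## Harris–Lan–Taylor–Thorne, Theorem A: the characterising property -/

/-- **HLTT's characterising property of `r_{ℓ,ι}(π)`** (published Thm. A, p. 3 = Cor. 7.14,
p. 232: "if `q ≠ p` is a rational prime above which `π` is unramified and if `v ∣ q` is a prime
of `E`, then `r_{p,ı}(π)` is unramified at `v` and
`r_{p,ı}(π)|^{ss}_{W_{E_v}} = ı⁻¹ rec_{E_v}(π_v |det|_v^{(1-n)/2})`"): for every rational prime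
`q ≠ ℓ` above which `π` is unramified (`IsUnramifiedAbove`: at *every* place over `q`) and every
place `v ∣ q` of `K`, `r` is compatible with `π` at `v` (`IsGaloisCompatibleAt`: unramified, with
the predicted characteristic polynomial of Frobenius).  No unramifiedness of `K` above `q` is
required in the published theorem (it is in the 2014 preprint arXiv:1411.6717, Thm. A, "above
which `π` and `E` are unramified", and in Thm. 7.13; Cor. 7.14 removes it by Sorensen's patching
lemma).  A *property of `r`*, not the theorem: existence and uniqueness of such an `r` are the
named facts `HarrisLanTaylorThorne2016.theoremA_existence` / `theoremA_uniqueness` of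
`ReciprocityGLnProofs`, whose `HarrisLanTaylorThorne2016.IsCompatible` is the definitionally
equal twin of this predicate.  Harris–Lan–Taylor–Thorne 2016, Thm. A (p. 3), Cor. 7.14 (p. 232).
[cite: HarrisLanTaylorThorneRMS2016, Thm. A and Cor. 7.14] -/
def IsCompatible (π : AutomorphicRepData (AutomorphyDatum.gl n K hcpt)) (ι : PadicAlgCl ℓ ≃+* ℂ)
    (r : GaloisRepresentations.FramedGaloisRep K (PadicAlgCl ℓ) n) : Prop :=
  ∀ q : ℕ, q.Prime → q ≠ ℓ → IsUnramifiedAbove π q →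
    ∀ v : HeightOneSpectrum (𝓞 K), ((q : ℕ) : 𝓞 K) ∈ v.asIdeal → IsGaloisCompatibleAt π ι r v

/-- **`HLTT.IsCompatible` written out** over the facts-free primitives `HasSatakeParamAt`,
`AutomorphicRepData.IsUnramifiedAt`, `FramedGaloisRep.IsUnramifiedAt`,
`FramedGaloisRep.HasFrobCharpolyAt`, `arithFrobPolyOfSatake` — definitionally (`Iff.rfl`).  The
right-hand side is, verbatim, the clause inlined in the items `WeightZeroNonOrdinaryPA`,
`UnramifiedFermatWitness`, `FLLiftingWeightZero` of route `Langlands/StickelbergerDial`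
(route-repair 2026-08-17). [folklore] -/
theorem isCompatible_iff (π : AutomorphicRepData (AutomorphyDatum.gl n K hcpt))
    (ι : PadicAlgCl ℓ ≃+* ℂ) (r : GaloisRepresentations.FramedGaloisRep K (PadicAlgCl ℓ) n) :
    IsCompatible π ι r ↔
      ∀ q : ℕ, q.Prime → q ≠ ℓ →
        (∀ w : HeightOneSpectrum (𝓞 K), ((q : ℕ) : 𝓞 K) ∈ w.asIdeal → π.IsUnramifiedAt w) →
        ∀ v : HeightOneSpectrum (𝓞 K), ((q : ℕ) : 𝓞 K) ∈ v.asIdeal →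
          ∀ α : Multiset ℂ, π.HasSatakeParamAt v α →
            r.IsUnramifiedAt v ∧
              r.HasFrobCharpolyAt v (arithFrobPolyOfSatake ι v.residueCard n α) :=
  Iff.rfl

/-- HLTT-compatibility is invariant under change of frame. [folklore] -/
theorem isCompatible_conj_iff (π : AutomorphicRepData (AutomorphyDatum.gl n K hcpt))
    (ι : PadicAlgCl ℓ ≃+* ℂ) (P : GL (Fin n) (PadicAlgCl ℓ))
    (r : GaloisRepresentations.FramedGaloisRep K (PadicAlgCl ℓ) n) :
    IsCompatible π ι (GaloisRepresentations.FramedRep.conj P r) ↔ IsCompatible π ι r := by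
  simp only [IsCompatible, isGaloisCompatibleAt_conj_iff]

/-- Compatibility at every `v ∤ ℓ` (the conclusion of **lang.S27**) implies HLTT-compatibility
(a place over a rational prime `q ≠ ℓ` does not lie over `ℓ`, `natCast_mem_asIdeal_iff_eq`).
[folklore] -/
theorem isCompatible_of_forall_not_mem {π : AutomorphicRepData (AutomorphyDatum.gl n K hcpt)}
    {ι : PadicAlgCl ℓ ≃+* ℂ} {r : GaloisRepresentations.FramedGaloisRep K (PadicAlgCl ℓ) n}
    (h : ∀ v : HeightOneSpectrum (𝓞 K), ((ℓ : ℕ) : 𝓞 K) ∉ v.asIdeal →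
      IsGaloisCompatibleAt π ι r v) :
    IsCompatible π ι r :=
  fun _q hq hqℓ _ v hv ↦ h _ fun hℓ ↦ hqℓ ((natCast_mem_asIdeal_iff_eq v hq Fact.out hv).1 hℓ).symm

/-- HLTT-compatibility gives compatibility at every place over a good rational prime; in
particular, granted `π.hasSatakeParamAt_cofinite`, at every place over all but finitely many
rational primes (`isUnramifiedAbove_cofinite`).  Pointwise form, for consumers that fix `q` and
`v`. [folklore] -/
theorem IsCompatible.isGaloisCompatibleAt {π : AutomorphicRepData (AutomorphyDatum.gl n K hcpt)}
    {ι : PadicAlgCl ℓ ≃+* ℂ} {r : GaloisRepresentations.FramedGaloisRep K (PadicAlgCl ℓ) n}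
    (h : IsCompatible π ι r) {q : ℕ} (hq : q.Prime) (hqℓ : q ≠ ℓ) (hπ : IsUnramifiedAbove π q)
    {v : HeightOneSpectrum (𝓞 K)} (hv : ((q : ℕ) : 𝓞 K) ∈ v.asIdeal) :
    IsGaloisCompatibleAt π ι r v :=
  h q hq hqℓ hπ v hv

end Compatible

end HLTT

end Literature.NumberTheory.Automorphic
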